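import Summits.QuantumFields.GaugeBoot.DiagonalRPTorusGaugeInvariantTwo
import Summits.QuantumFields.GaugeBoot.DiagonalRPTorusOddStaircasePrep
import HarnessLib

/-!
# Diagonal RP on the even two-torus, gauge-invariant sector, all couplings — I: half-gauge
averaging (gauge-boot, L3 supplement)

HONEST FRAMING (cell `pub-gaugeboot`, page 1 of every file): the venture produces certified bounds
on lattice expectations at stated coupling, gauge group, dimension and torus size; NOT a mass gap,
NOT a continuum limit, NOT a string tension; NOT Yang–Mills-summit-bearing (barriers
`FixedCouplingUltralocality`, `PerturbativeInvisibility`). This module is part of a POSITIVE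
structural result (`DiagonalRPTorusEvenGaugeInvariantAllGroups.lean`): on `(ℤ/L)²`, `L ≥ 4` even,
closed-half diagonal reflection positivity HOLDS for gauge-invariant observables at EVERY real `β`
for EVERY compact metrisable gauge group.

Setting of `DiagonalRPTorusGaugeInvariantTwo.lean`: `Z⟨(ΘF)‾F⟩ = e^{-βN#P} ∫ g conj(g∘Θ) E dU`
with `g = F e^{β S_int}` (`gObs`) supported on the closed-half links and `E = crossE` the weight of
the two cut layers `k = 0` (mirror sites `dg t = (t,t)`) and `k = c = L/2` (sites `dgc t`). Here:

* `halfGauge i j y x` — the **half-gauge transformation**: the gauge transformation by the bump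
  `Pi.mulSingle y x` applied to the closed-half links ONLY. It preserves product Haar measure
  (`measurePreserving_halfGauge`), fixes `g` for gauge-invariant `F` (`gObs_halfGauge`) and fixes
  `g∘Θ` (`gObs_configDiagSwap_halfGauge`; for even `L` the two closed halves share no link);
* ★ `integral_gg_mul_eq_avg` — hence `∫ g conj(g∘Θ) R dU = ∫ g conj(g∘Θ) (∫ R∘halfGauge_{y,x} dx) dU`
  for every continuous weight `R` and every site `y`: the cut weight may be AVERAGED over the
  half-gauge group at the mirror sites;
* the effect on the crossing transports: at a mirror site `C_y ↦ x_y C_y x_{y'}⁻¹`, `D_y` fixed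
  (`cT_halfGauge_of_kd_zero`, `dT_halfGauge_of_kd_zero`), at a back-layer site `D_y ↦ x_y D_y x_{y'}⁻¹`,
  `C_y` fixed (`dT_halfGauge_of_kd_cc`, `cT_halfGauge_of_kd_cc`); bumps on other layers are
  invisible. (The back-layer sites and staircases: `DiagonalRPTorusEvenBackLayer.lean`.)

References (mechanism): A. A. Migdal, Sov. Phys. JETP 42 (1975) 413 (2D gluing); K. Osterwalder,
E. Seiler, Ann. Phys. 110 (1978) 440, §2.
-/

open MeasureTheory Complex Finset Function
open scoped ComplexOrder ENNReal

namespace Summit.QuantumFields.GaugeBoot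

open Literature.MathematicalPhysics.QuantumFieldTheory
open Literature.RepresentationTheory.CompactGroups

noncomputable section

namespace DiagRPTwo

/-! ## The half-gauge transformation -/

section HalfGauge

variable {L : ℕ} {G : Type*} [Group G]

/-- The bump gauge function: `x` at the site `y`, `1` elsewhere. -/
def bump (y : Site 2 L) (x : G) : Site 2 L → G := Pi.mulSingle y x

/-- The bump at its own site. -/
@[simp] theorem bump_self (y : Site 2 L) (x : G) : bump y x y = x := by
  simp only [bump, Pi.mulSingle_eq_same]

/-- The bump elsewhere. -/
theorem bump_of_ne {y z : Site 2 L} (h : z ≠ y) (x : G) : bump y x z = 1 := by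
  simp only [bump, Pi.mulSingle_eq_of_ne h]

variable [NeZero L] (i j : Fin 2)

/-- **Half-gauge transformation** at the site `y` by `x`: the closed-half links are gauge
transformed by the bump `z ↦ (z = y ? x : 1)`, the other links are untouched. -/
def halfGauge (y : Site 2 L) (x : G) (U : GaugeConfig 2 L G) : GaugeConfig 2 L G := fun e =>
  if e ∈ halfLinks i j then gaugeTransform (bump y x) U e else U e

variable {i j}

/-- On a closed-half link the half-gauge transformation is the gauge transformation. -/
theorem halfGauge_apply_of_mem {y : Site 2 L} {x : G} {U : GaugeConfig 2 L G} {e : Edge 2 L}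
    (he : e ∈ halfLinks i j) : halfGauge i j y x U e = gaugeTransform (bump y x) U e := by
  simp only [halfGauge, he, ↓reduceIte]

/-- Off the closed half the half-gauge transformation does nothing. -/
theorem halfGauge_apply_of_not_mem {y : Site 2 L} {x : G} {U : GaugeConfig 2 L G} {e : Edge 2 L}
    (he : e ∉ halfLinks i j) : halfGauge i j y x U e = U e := by
  simp only [halfGauge, he, ↓reduceIte]

/-- A link not touching `y` is untouched. -/
theorem halfGauge_apply_eq_self {y : Site 2 L} {x : G} {U : GaugeConfig 2 L G} {e : Edge 2 L}
    (h1 : e.1 ≠ y) (h2 : e.1.shift e.2 ≠ y) : halfGauge i j y x U e = U e := by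
  by_cases he : e ∈ halfLinks i j
  · rw [halfGauge_apply_of_mem he, gaugeTransform, bump_of_ne h1, bump_of_ne h2, one_mul, inv_one,
      mul_one]
  · exact halfGauge_apply_of_not_mem he

/-- The half-gauge transformation is a coordinatewise two-sided translation. -/
theorem halfGauge_eq_pi (y : Site 2 L) (x : G) :
    halfGauge i j y x = fun (U : GaugeConfig 2 L G) (e : Edge 2 L) =>
      (if e ∈ halfLinks i j then bump y x e.1 else 1) * U e *
        (if e ∈ halfLinks i j then (bump y x (e.1.shift e.2))⁻¹ else 1) := by
  funext U e
  by_cases he : e ∈ halfLinks i j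
  · simp only [halfGauge_apply_of_mem he, gaugeTransform, he, ↓reduceIte]
  · simp only [halfGauge_apply_of_not_mem he, he, ↓reduceIte, one_mul, mul_one]

variable [TopologicalSpace G] [IsTopologicalGroup G] [CompactSpace G] [MeasurableSpace G] [BorelSpace G]

/-- **The half-gauge transformation preserves product Haar measure.** -/
theorem measurePreserving_halfGauge (y : Site 2 L) (x : G) :
    MeasurePreserving (halfGauge (G := G) i j y x) (linkMeasure L G) (linkMeasure L G) := by
  rw [halfGauge_eq_pi]
  exact measurePreserving_pi (fun _ : Edge 2 L => haarProbability G)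
    (fun _ : Edge 2 L => haarProbability G) fun e => WilsonGauge.measurePreserving_mul_mul _ _

omit [CompactSpace G] [MeasurableSpace G] [BorelSpace G] in
/-- The half-gauge transformation is jointly continuous in the group element and the configuration. -/
theorem continuous_halfGauge (y : Site 2 L) :
    Continuous fun p : G × GaugeConfig 2 L G => halfGauge i j y p.1 p.2 := by
  refine continuous_pi fun e => ?_
  have hb : ∀ z : Site 2 L, Continuous fun x : G => bump y x z := by
    intro z
    by_cases hz : z = y
    · subst hz; simp only [bump_self]; exact continuous_id
    · simp only [bump_of_ne hz]; exact continuous_const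
  by_cases he : e ∈ halfLinks i j
  · simp only [halfGauge, he, ↓reduceIte, gaugeTransform]
    exact (((hb _).comp continuous_fst).mul ((continuous_apply e).comp continuous_snd)).mul
      ((hb _).comp continuous_fst).inv
  · simp only [halfGauge, he, ↓reduceIte]
    exact (continuous_apply e).comp continuous_snd

end HalfGauge

/-! ## The half-gauge transformation fixes `g` and `g ∘ Θ` -/

section Invariance

variable {L N : ℕ} [NeZero L] {G : Type*} [Group G] [TopologicalSpace G] [IsTopologicalGroup G]
  [CompactSpace G] (ρ : G →* Matrix (Fin N) (Fin N) ℂ)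

omit [TopologicalSpace G] [IsTopologicalGroup G] [CompactSpace G] in
/-- `g` is fixed: on the closed half the half-gauge map is a gauge transformation. -/
theorem gObs_halfGauge (h4 : 4 ≤ L) {i j : Fin 2} (hij : i ≠ j) (β : ℝ)
    {F : GaugeConfig 2 L G → ℂ} (hFH : IsDiagonalHalfObservable i j F) (hFg : IsGaugeInvariant F)
    (y : Site 2 L) (x : G) (U : GaugeConfig 2 L G) :
    gObs ρ i j β F (halfGauge i j y x U) = gObs ρ i j β F U := by
  rw [← gObs_gaugeTransform ρ i j β hFg (bump y x) U]
  exact dependsOn_gObs ρ h4 hij β hFH fun e he => halfGauge_apply_of_mem (Finset.mem_coe.1 he)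

omit [TopologicalSpace G] [IsTopologicalGroup G] [CompactSpace G] in
/-- `g ∘ Θ` is fixed: for even `L ≥ 4` the swap carries closed-half links off the closed half. -/
theorem gObs_configDiagSwap_halfGauge (hL : Even L) (h4 : 4 ≤ L) {i j : Fin 2} (hij : i ≠ j)
    (β : ℝ) {F : GaugeConfig 2 L G → ℂ} (hFH : IsDiagonalHalfObservable i j F)
    (y : Site 2 L) (x : G) (U : GaugeConfig 2 L G) :
    gObs ρ i j β F (configDiagSwap i j (halfGauge i j y x U)) = gObs ρ i j β F (configDiagSwap i j U) := by
  refine dependsOn_gObs ρ h4 hij β hFH fun e he => ?_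
  show halfGauge i j y x U (edgeDiagSwap i j e) = U (edgeDiagSwap i j e)
  exact halfGauge_apply_of_not_mem fun he' =>
    not_inHalf_edgeDiagSwap hL h4 hij (mem_halfLinks.1 (Finset.mem_coe.1 he)) (mem_halfLinks.1 he')

end Invariance

/-! ## The averaging lemma -/

section Averaging

variable {L N : ℕ} [NeZero L] {G : Type*} [Group G] [TopologicalSpace G] [IsTopologicalGroup G]
  [CompactSpace G] [MeasurableSpace G] [BorelSpace G] [SecondCountableTopology G]
  (ρ : G →* Matrix (Fin N) (Fin N) ℂ)

/-- The pairing factor `g(U) conj g(ΘU)` (blind to half-gauge transformations). -/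
def gg (i j : Fin 2) (β : ℝ) (F : GaugeConfig 2 L G → ℂ) (U : GaugeConfig 2 L G) : ℂ :=
  gObs ρ i j β F U * (starRingEnd ℂ) (gObs ρ i j β F (configDiagSwap i j U))

omit [CompactSpace G] in
/-- `gg` is measurable. -/
theorem measurable_gg (i j : Fin 2) (hρ : Continuous ρ) (β : ℝ) {F : GaugeConfig 2 L G → ℂ}
    (hF : Measurable F) : Measurable (gg ρ i j β F) := by
  have hg := measurable_gObs ρ i j hρ β hF
  have hΘ : Measurable (configDiagSwap (G := G) (L := L) i j) :=
    measurable_pi_lambda _ fun e => measurable_pi_apply _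
  exact hg.mul (Complex.continuous_conj.measurable.comp (hg.comp hΘ))

omit [MeasurableSpace G] [BorelSpace G] [SecondCountableTopology G] in
/-- `gg` is bounded. -/
theorem norm_gg_le (i j : Fin 2) (hρ : Continuous ρ) (β : ℝ) {F : GaugeConfig 2 L G → ℂ} {CF : ℝ}
    (hFb : ∀ U, ‖F U‖ ≤ CF) (U : GaugeConfig 2 L G) :
    ‖gg ρ i j β F U‖ ≤ (CF * Real.exp (|β| * ((Sp (L := L) i j).card * N))) ^ 2 := by
  unfold gg
  rw [norm_mul, Complex.norm_conj, sq]
  have h0 : 0 ≤ CF * Real.exp (|β| * ((Sp (L := L) i j).card * N)) :=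
    (norm_nonneg _).trans (norm_gObs_le ρ i j hρ β hFb U)
  exact mul_le_mul (norm_gObs_le ρ i j hρ β hFb U) (norm_gObs_le ρ i j hρ β hFb _) (norm_nonneg _) h0

omit [TopologicalSpace G] [IsTopologicalGroup G] [CompactSpace G] [MeasurableSpace G] [BorelSpace G]
  [SecondCountableTopology G] in
/-- `gg` is fixed by every half-gauge transformation (gauge-invariant closed-half `F`, even `L ≥ 4`). -/
theorem gg_halfGauge (hL : Even L) (h4 : 4 ≤ L) {i j : Fin 2} (hij : i ≠ j) (β : ℝ)
    {F : GaugeConfig 2 L G → ℂ} (hFH : IsDiagonalHalfObservable i j F) (hFg : IsGaugeInvariant F)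
    (y : Site 2 L) (x : G) (U : GaugeConfig 2 L G) :
    gg ρ i j β F (halfGauge i j y x U) = gg ρ i j β F U := by
  rw [gg, gg, gObs_halfGauge ρ h4 hij β hFH hFg, gObs_configDiagSwap_halfGauge ρ hL h4 hij β hFH]

/-- ★ **Half-gauge averaging**: for a gauge-invariant closed-half observable `F` and every
continuous real weight `R`, the cut weight may be averaged over the half-gauge group at any site:
`∫ g conj(g∘Θ) R dU = ∫ g conj(g∘Θ) (∫ R(halfGauge_{y,x} U) dx) dU` (`L ≥ 4` even). -/
theorem integral_gg_mul_eq_avg (hL : Even L) (h4 : 4 ≤ L) {i j : Fin 2} (hij : i ≠ j)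
    (hρ : Continuous ρ) (β : ℝ) {F : GaugeConfig 2 L G → ℂ} (hF : Measurable F)
    {CF : ℝ} (hFb : ∀ U, ‖F U‖ ≤ CF) (hFH : IsDiagonalHalfObservable i j F) (hFg : IsGaugeInvariant F)
    {R : GaugeConfig 2 L G → ℝ} (hR : Continuous R) (y : Site 2 L) :
    ∫ U, gg ρ i j β F U * (R U : ℂ) ∂(linkMeasure L G) =
      ∫ U, gg ρ i j β F U * ((∫ x, R (halfGauge i j y x U) ∂(haarProbability G) : ℝ) : ℂ)
        ∂(linkMeasure L G) := by
  -- (1) for every `x`, substitute `U ↦ halfGauge y x U`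
  have hmeas : Measurable fun U : GaugeConfig 2 L G => gg ρ i j β F U * (R U : ℂ) :=
    (measurable_gg ρ i j hρ β hF).mul (Complex.measurable_ofReal.comp hR.measurable)
  have h1 : ∀ x : G, ∫ U, gg ρ i j β F U * (R U : ℂ) ∂(linkMeasure L G) =
      ∫ U, gg ρ i j β F U * (R (halfGauge i j y x U) : ℂ) ∂(linkMeasure L G) := by
    intro x
    rw [← LatticeRP.integral_comp_eq_of_measurePreserving (measurePreserving_halfGauge (i := i)
      (j := j) y x) hmeas]
    refine integral_congr_ae (ae_of_all _ fun U => ?_)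
    dsimp only
    rw [gg_halfGauge ρ hL h4 hij β hFH hFg]
  -- (2) average over `x` and swap the integrals
  obtain ⟨CR, hCR⟩ := isCompact_univ.exists_bound_of_continuousOn hR.continuousOn
  have hK : ∀ U, ‖gg ρ i j β F U‖ ≤ (CF * Real.exp (|β| * ((Sp (L := L) i j).card * N))) ^ 2 :=
    norm_gg_le ρ i j hρ β hFb
  set K : ℝ := (CF * Real.exp (|β| * ((Sp (L := L) i j).card * N))) ^ 2 with hKdef
  have hint : Integrable (Function.uncurry fun (x : G) (U : GaugeConfig 2 L G) =>
      gg ρ i j β F U * (R (halfGauge i j y x U) : ℂ))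
      ((haarProbability G).prod (linkMeasure L G)) := by
    refine Integrable.of_bound (C := K * CR) ?_ (ae_of_all _ fun p => ?_)
    · exact (((measurable_gg ρ i j hρ β hF).comp measurable_snd).mul
        (Complex.measurable_ofReal.comp (hR.comp (continuous_halfGauge y)).measurable)).aestronglyMeasurable
    · rw [Function.uncurry_apply_pair, norm_mul, Complex.norm_real]
      exact mul_le_mul (hK _) (hCR _ (Set.mem_univ _)) (norm_nonneg _)
        ((norm_nonneg _).trans (hK p.2))
  calc ∫ U, gg ρ i j β F U * (R U : ℂ) ∂(linkMeasure L G)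
      = ∫ x, ∫ U, gg ρ i j β F U * (R (halfGauge i j y x U) : ℂ) ∂(linkMeasure L G)
          ∂(haarProbability G) := by
        simp_rw [← h1]; simp
    _ = ∫ U, ∫ x, gg ρ i j β F U * (R (halfGauge i j y x U) : ℂ) ∂(haarProbability G)
          ∂(linkMeasure L G) := integral_integral_swap hint
    _ = _ := by
        refine integral_congr_ae (ae_of_all _ fun U => ?_)
        show ∫ x, gg ρ i j β F U * (R (halfGauge i j y x U) : ℂ) ∂(haarProbability G) = _
        rw [integral_const_mul, integral_complex_ofReal]

end Averaging

/-! ## The crossing transports under a half-gauge transformation -/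

section Transports

variable {L : ℕ} [NeZero L] {G : Type*} [Group G] {i j : Fin 2}

/-- The two links of `D_y` for `y` ON THE MIRROR are not links of the closed half (they lie in the
opposite half; `L ≥ 4`). -/
theorem not_inHalf_dT_links_zero (h4 : 4 ≤ L) (hij : i ≠ j) {y : Site 2 L} (hy : kd i j y = 0) :
    ¬InHalf i j (y, j) ∧ ¬InHalf i j (y.shift j, i) := by
  have h10 : (1 : ZMod L) ≠ 0 := by
    intro h; have := val_one_of_four_le h4; rw [h, ZMod.val_zero] at this; omega
  have hv : (kd i j (y.shift j)).val = L - 1 := by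
    rw [kd_shift_right hij, hy, zero_sub, val_neg_of_ne_zero' h10, val_one_of_four_le h4]
  refine ⟨fun h => ?_, fun h => ?_⟩
  · have := h.2; simp only at this; rw [hv] at this; omega
  · have := h.1; simp only at this; rw [hv] at this; omega

omit [NeZero L] in
/-- The two links of `C_y` for `y` on the BACK LAYER are not links of the closed half (`L ≥ 4` even). -/
theorem not_inHalf_cT_links_cc (hL : Even L) (h4 : 4 ≤ L) (hij : i ≠ j) {y : Site 2 L}
    (hy : kd i j y = cc L) : ¬InHalf i j (y, i) ∧ ¬InHalf i j (y.shift i, j) := by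
  obtain ⟨r, hr⟩ := hL
  have hv : (kd i j (y.shift i)).val = L / 2 + 1 := by
    rw [kd_shift_left hij, hy, ZMod.val_add_of_lt, cc_val h4, val_one_of_four_le h4]
    rw [cc_val h4, val_one_of_four_le h4]; omega
  refine ⟨fun h => ?_, fun h => ?_⟩
  · have := h.2; simp only at this; rw [hv] at this; omega
  · have := h.1; simp only at this; rw [hv] at this; omega

/-- ★ At a mirror site: `C_y ↦ x_y C_y x_{y+e_i+e_j}⁻¹` (`x_z` the bump at `z`). -/
theorem cT_halfGauge_of_kd_zero (h4 : 4 ≤ L) (hij : i ≠ j) (z : Site 2 L) (x : G)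
    (U : GaugeConfig 2 L G) {y : Site 2 L} (hy : kd i j y = 0) :
    cT i j (halfGauge i j z x U) y =
      bump z x y * cT i j U y * (bump z x ((y.shift i).shift j))⁻¹ := by
  obtain ⟨h1, h2⟩ := inHalf_cT_links h4 hij hy
  rw [cT, halfGauge_apply_of_mem (mem_halfLinks.2 h1), halfGauge_apply_of_mem (mem_halfLinks.2 h2)]
  simp only [gaugeTransform, cT]
  group

/-- At a mirror site `D_y` is untouched. -/
theorem dT_halfGauge_of_kd_zero (h4 : 4 ≤ L) (hij : i ≠ j) (z : Site 2 L) (x : G)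
    (U : GaugeConfig 2 L G) {y : Site 2 L} (hy : kd i j y = 0) :
    dT i j (halfGauge i j z x U) y = dT i j U y := by
  obtain ⟨h1, h2⟩ := not_inHalf_dT_links_zero h4 hij hy
  rw [dT, dT, halfGauge_apply_of_not_mem (fun h => h1 (mem_halfLinks.1 h)),
    halfGauge_apply_of_not_mem (fun h => h2 (mem_halfLinks.1 h))]

/-- ★ On the back layer: `D_y ↦ x_y D_y x_{y+e_i+e_j}⁻¹`. -/
theorem dT_halfGauge_of_kd_cc (h4 : 4 ≤ L) (hij : i ≠ j) (z : Site 2 L) (x : G)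
    (U : GaugeConfig 2 L G) {y : Site 2 L} (hy : kd i j y = cc L) :
    dT i j (halfGauge i j z x U) y =
      bump z x y * dT i j U y * (bump z x ((y.shift j).shift i))⁻¹ := by
  obtain ⟨h1, h2⟩ := inHalf_dT_links h4 hij hy
  rw [dT, halfGauge_apply_of_mem (mem_halfLinks.2 h1), halfGauge_apply_of_mem (mem_halfLinks.2 h2)]
  simp only [gaugeTransform, dT]
  group

/-- On the back layer `C_y` is untouched (`L ≥ 4` even). -/
theorem cT_halfGauge_of_kd_cc (hL : Even L) (h4 : 4 ≤ L) (hij : i ≠ j) (z : Site 2 L) (x : G)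
    (U : GaugeConfig 2 L G) {y : Site 2 L} (hy : kd i j y = cc L) :
    cT i j (halfGauge i j z x U) y = cT i j U y := by
  obtain ⟨h1, h2⟩ := not_inHalf_cT_links_cc hL h4 hij hy
  rw [cT, cT, halfGauge_apply_of_not_mem (fun h => h1 (mem_halfLinks.1 h)),
    halfGauge_apply_of_not_mem (fun h => h2 (mem_halfLinks.1 h))]

/-- The bump at a site of another diagonal layer is invisible to `C_y` on the mirror. -/
theorem cT_halfGauge_of_kd_zero_of_ne (h4 : 4 ≤ L) (hij : i ≠ j) {z : Site 2 L} (hz : kd i j z ≠ 0)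
    (x : G) (U : GaugeConfig 2 L G) {y : Site 2 L} (hy : kd i j y = 0) :
    cT i j (halfGauge i j z x U) y = cT i j U y := by
  have hy' : kd i j ((y.shift i).shift j) = 0 := by rw [kd_shift_right hij, kd_shift_left hij, hy]; ring
  have h1 : y ≠ z := fun h => hz (h ▸ hy)
  have h2 : (y.shift i).shift j ≠ z := fun h => hz (h ▸ hy')
  rw [cT_halfGauge_of_kd_zero h4 hij z x U hy, bump_of_ne h1, bump_of_ne h2, one_mul, inv_one, mul_one]

/-- The bump at a site of another diagonal layer is invisible to `D_y` on the back layer. -/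
theorem dT_halfGauge_of_kd_cc_of_ne (h4 : 4 ≤ L) (hij : i ≠ j) {z : Site 2 L}
    (hz : kd i j z ≠ cc L) (x : G) (U : GaugeConfig 2 L G) {y : Site 2 L} (hy : kd i j y = cc L) :
    dT i j (halfGauge i j z x U) y = dT i j U y := by
  have hy' : kd i j ((y.shift j).shift i) = cc L := by
    rw [kd_shift_left hij, kd_shift_right hij, hy]; ring
  have h1 : y ≠ z := fun h => hz (h ▸ hy)
  have h2 : (y.shift j).shift i ≠ z := fun h => hz (h ▸ hy')
  rw [dT_halfGauge_of_kd_cc h4 hij z x U hy, bump_of_ne h1, bump_of_ne h2, one_mul, inv_one, mul_one]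

end Transports

end DiagRPTwo

end

end Summit.QuantumFields.GaugeBoot
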